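/-
b2b-lace packet, ANALYTIC ORACLE seat gen 8 (unit `b2b-lace-oracle-g8`).  The evaluation of `V_{n,2j}` through the
tree's `I` and `W` integrals at the node `2e_i` — the typed form of [NoBLE17] (5.25) adapted to the tree's orbit
toolkit.  d-generic; no dimension sentence.
-/
import Literature.Probability.FitznerVanDerHofstad2017.SrwIntegralUZero
import Literature.Probability.FitznerVanDerHofstad2017.SrwIntegralWSplit
import HarnessLib

/-!
# `V_{n,2j} = (2d)⁻² [ I_{n,2j}(0) − 2 I_{n,2j}(2e_i) + W_{n,j}(2e_i) ]`

CITATION HEADER (PLACEMENT v2). Part of a certified REPRODUCTION of R. Fitzner, R. van der Hofstad,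
*Generalized approach to the non-backtracking lace expansion*, Probab. Theory Related Fields 169 (2017)
1041–1119 [NoBLE17] (arXiv:1506.07969), §5.2, as consumed by [FvdH17] (EJP 22 no. 43) Prop. 2.2:

> [NoBLE17] §5.2 p. 1093, "Computation of `V_{n,l}`": "The equality (3.27) implies that
> `D̂^{sin}(k)² = (2d)⁻² [1 − D̂(2k)]²` … From this, we conclude that
> `V_{n,l} = (2d)⁻² ( I_{n,l}(0) − 2 I_{n,l}(2e₁) + ((d−1)/d) I_{n,l}(2e₁+2e₂) + (2d)⁻¹ I_{n,l}(0) + (2d)⁻¹ I_{n,l}(4e₁) )`" ((5.25)).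

## What is here (a kernel theorem; the cite is a locator)

Expanding `[1 − D̂(2k)]² = 1 − 2D̂^{(2e_i)}(k) + D̂^{(2e_i)}(k)²` (`DhatSym_single_two`) under the integral gives, for
even `l = 2j` and `d ≥ 2n + 1`,

  **`srwV_even_eq`**: `V_{n,2j} = (2d)⁻² [ I_{n,2j}(0) − 2 I_{n,2j}(2e_i) + W_{n,j}(2e_i) ]`,

where `W_{n,j}(x) = ∫ D̂^{2j} (D̂^{(x)})² Ĉⁿ` is the tree's `srwW` (`SrwIntegralWSplit`).  This is (5.25) with its last
three terms left assembled as `W_{n,j}(2e₁)`: the printed evaluation of that square,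
`W_{n,j}(2e₁) = ((d−1)/d) I_{n,2j}(2e₁+2e₂) + (2d)⁻¹ [I_{n,2j}(0) + I_{n,2j}(4e₁)]`, is the placement formula (5.16)
(`srwW_eq_orbit_sum`) at `x = 2e₁`, whose node-class evaluation the tree leaves to the certifying engines (they already
supply `srwW d n j (axisVec 0 2)`, cf. `SrwIntegralSupFinite`).  Hence the `U`-table rule (5.9)+(5.25) of `SRW.nb` is
available as `srwU_le_sqrt_srwV_mul_srwL` + `srwV_even_eq` over engine inputs `I_{n,2j}(0)`, `I_{n,2j}(2e₁)` (two-sided)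
and `W_{n,j}(2e₁)`, `L_n(x)` (upper).
-/

noncomputable section

open MeasureTheory Real Finset
open scoped BigOperators

namespace Literature.Probability.FitznerVanDerHofstad2017

open Literature.Barriers.CriticalPhenomena
open Literature.Barriers.CriticalPhenomena.Slade2006Prop53 (P)

variable {d : ℕ}

/-- The pointwise identity behind (5.25): `D̂^{2j} (D̂^{sin})² Ĉⁿ =
(2d)⁻² [D̂^{2j} D̂^{(0)} Ĉⁿ − 2 D̂^{2j} D̂^{(2e_i)} Ĉⁿ + D̂^{2j} (D̂^{(2e_i)})² Ĉⁿ]`.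
[cite: FitznerVanDerHofstad2016NoBLE, §5.2 (5.25) p. 1093] -/
theorem srwV_even_integrand (hd : 1 ≤ d) (n j : ℕ) (i : Fin d) (k : Fin d → ℝ) :
    (Dhat d k ^ (2 * j) * Dsin d k ^ 2) * Chat d 1 k ^ n =
      (((Dhat d k ^ (2 * j) * DhatSym d 0 k) * Chat d 1 k ^ n
        - 2 * ((Dhat d k ^ (2 * j) * DhatSym d (Pi.single i 2) k) * Chat d 1 k ^ n))
        + (Dhat d k ^ (2 * j) * DhatSym d (Pi.single i 2) k ^ 2) * Chat d 1 k ^ n) / (2 * d) ^ 2 := by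
  rw [DhatSym_zero, DhatSym_single_two, Dsin_eq_half_angle hd]
  ring

/-- **(5.25), assembled form: `V_{n,2j} = (2d)⁻² [I_{n,2j}(0) − 2 I_{n,2j}(2e_i) + W_{n,j}(2e_i)]`** (`d ≥ 2n + 1`).
[cite: FitznerVanDerHofstad2016NoBLE, §5.2 (5.25) p. 1093] -/
theorem srwV_even_eq {n : ℕ} (hd : 2 * n + 1 ≤ d) (j : ℕ) (i : Fin d) :
    srwV d n (2 * j) =
      (srwI d n (2 * j) 0 - 2 * srwI d n (2 * j) (Pi.single i 2) + srwW d n j (Pi.single i 2)) / (2 * d) ^ 2 := by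
  have hd1 : 1 ≤ d := by omega
  have hA := integrable_srwI_integrand hd (2 * j) (0 : Fin d → ℤ)
  have hB := integrable_srwI_integrand hd (2 * j) (Pi.single i (2 : ℤ))
  have hC := integrable_srwW_integrand hd j (Pi.single i (2 : ℤ))
  unfold srwV srwI srwW
  have e : ∫ k, (Dhat d k ^ (2 * j) * Dsin d k ^ 2) * Chat d 1 k ^ n ∂P d =
      ∫ k, (((Dhat d k ^ (2 * j) * DhatSym d 0 k) * Chat d 1 k ^ n
        - 2 * ((Dhat d k ^ (2 * j) * DhatSym d (Pi.single i 2) k) * Chat d 1 k ^ n))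
        + (Dhat d k ^ (2 * j) * DhatSym d (Pi.single i 2) k ^ 2) * Chat d 1 k ^ n) / (2 * d) ^ 2 ∂P d :=
    integral_congr_ae (ae_of_all _ fun k => srwV_even_integrand hd1 n j i k)
  have hAB : Integrable (fun k => (Dhat d k ^ (2 * j) * DhatSym d 0 k) * Chat d 1 k ^ n
      - 2 * ((Dhat d k ^ (2 * j) * DhatSym d (Pi.single i 2) k) * Chat d 1 k ^ n)) (P d) :=
    hA.sub (hB.const_mul 2)
  rw [e, integral_div, integral_add hAB hC, integral_sub hA (hB.const_mul 2), integral_const_mul]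
  ring

end Literature.Probability.FitznerVanDerHofstad2017
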